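import Summits.AnomalousDissipation.AnomalousDissipation.Theorems.TaylorCertificatesKolmogorovFloorDictionaryShear
import Summits.AnomalousDissipation.AnomalousDissipation.Theorems.TaylorCertificatesKolmogorovFloorDictionaryPairing

/-!
# DICTIONARY of line `Sketch` (digit-frame-closure), crux KolmogorovFloor: the four Fourier-side facts

`fourierDictionary` assembles, in the exact shape consumed by the line's skeleton, the four conjuncts proved in
`TaylorCertificatesKolmogorovFloorDictionaryShear` (namespace `…Response.Dictionary`; (D1) `shearField_facts`: the integer-amplitude Kolmogorov shear
`U = sin(2π ξ·x) e` is a smooth solenoidal mean-zero exact steady Euler state with coefficients `shearCoeff`,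
energy `(e·e)/2`, enstrophy `2π²(ξ·ξ)(e·e)`; (D2) `fc_linearisedTransport`: `𝓕[(U·∇)b + (b·∇)U] = linOp ξ e C`
on real trigonometric polynomials `b`) and `TaylorCertificatesKolmogorovFloorDictionaryPairing` ((D3)
`abs_integral_inner_le_slope_sum`: the beat-dual pairing bound against band-limited solenoidal multipliers of
slope `≤ M`, gradients invisible; (D4) `abs_integral_inner_convect_realTrigPoly_le`: self-advection of a solenoidal
trigonometric polynomial pairs to at most `2π M (Σ‖C‖)²`).
-/

noncomputable section

set_option linter.dupNamespace false

open MeasureTheory Matrix Finset UnitAddTorus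
open scoped BigOperators ComplexConjugate InnerProductSpace

namespace Summit.AnomalousDissipation.AnomalousDissipation.Theorems.KolmogorovFloor.Response

open Literature.Analysis.FunctionSpaces Literature.Analysis.FluidPDE

/-- **DICTIONARY.** (D1) the integer-amplitude Kolmogorov shear is a smooth solenoidal mean-zero exact Euler state
with explicit coefficients, energy `e·e/2` and enstrophy `2π²(ξ·ξ)(e·e)`; (D2) the Fourier side of
`(U·∇)b + (b·∇)U` on trigonometric polynomials is `linOp`; (D3) the beat-dual pairing bound against band-limited
solenoidal multipliers, gradients invisible; (D4) self-advection of a solenoidal trigonometric polynomial pairs to at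
most `2π M (Σ‖C‖)²`. -/
theorem fourierDictionary :
    (∀ (R : ℕ) (ξ e : Fin 3 → ℤ), ξ ≠ 0 → ξ ⬝ᵥ e = 0 → ξ ∈ Torus.freqBall R →
      Torus.IsSmooth (shearField R ξ e) ∧ Torus.IsDivFree (shearField R ξ e) ∧
      Torus.HasZeroMean (shearField R ξ e) ∧ (∀ x, Torus.convect (shearField R ξ e) (shearField R ξ e) x = 0) ∧
      (∀ κ, mFourierCoeff (EuclideanSpace.complexify ∘ shearField R ξ e) κ = shearCoeff ξ e κ) ∧
      (∫ x, ‖shearField R ξ e x‖ ^ 2) = ((e ⬝ᵥ e : ℤ) : ℝ) / 2 ∧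
      (Torus.eGradNormSq (shearField R ξ e)).toReal = 2 * Real.pi ^ 2 * ((ξ ⬝ᵥ ξ : ℤ) : ℝ) * ((e ⬝ᵥ e : ℤ) : ℝ)) ∧
    (∀ (R : ℕ) (ξ e : Fin 3 → ℤ) (C : (Fin 3 → ℤ) → EuclideanSpace ℂ (Fin 3)), ξ ≠ 0 → ξ ⬝ᵥ e = 0 →
      ξ ∈ Torus.freqBall R → Torus.IsConjSymm C → (∀ κ, κ ∉ Torus.freqBall R → C κ = 0) →
      ∀ κ, mFourierCoeff (EuclideanSpace.complexify ∘ fun x =>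
          Torus.convect (shearField R ξ e) (Torus.realTrigPoly (Torus.freqBall R) C) x +
          Torus.convect (Torus.realTrigPoly (Torus.freqBall R) C) (shearField R ξ e) x) κ = linOp ξ e C κ) ∧
    (∀ (r W : UnitAddTorus (Fin 3) → EuclideanSpace ℝ (Fin 3)) (N : ℕ) (M : ℝ) (q : (Fin 3 → ℤ) → ℂ),
      Torus.IsSmooth r → Torus.IsSmooth W → Torus.IsDivFree W → Torus.HasZeroMean W →
      (∀ κ, (N : ℝ) ^ 2 < Torus.freqNormSq κ → mFourierCoeff (EuclideanSpace.complexify ∘ W) κ = 0) →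
      (∀ κ, Real.sqrt (Torus.freqNormSq κ) * ‖mFourierCoeff (EuclideanSpace.complexify ∘ W) κ‖ ≤ M) →
      |∫ x, ⟪r x, W x⟫_ℝ| ≤ M * ∑ κ ∈ (Torus.freqBall N).erase 0,
        ‖mFourierCoeff (EuclideanSpace.complexify ∘ r) κ - q κ • Torus.freqVec κ‖ / Real.sqrt (Torus.freqNormSq κ)) ∧
    (∀ (S : Finset (Fin 3 → ℤ)) (C : (Fin 3 → ℤ) → EuclideanSpace ℂ (Fin 3))
      (W : UnitAddTorus (Fin 3) → EuclideanSpace ℝ (Fin 3)) (N : ℕ) (M : ℝ),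
      (∀ κ ∈ S, -κ ∈ S) → Torus.IsConjSymm C → (∀ κ ∈ S, ∑ i, (κ i : ℂ) * C κ i = 0) → 0 ≤ M →
      Torus.IsSmooth W → Torus.IsDivFree W → Torus.HasZeroMean W →
      (∀ κ, (N : ℝ) ^ 2 < Torus.freqNormSq κ → mFourierCoeff (EuclideanSpace.complexify ∘ W) κ = 0) →
      (∀ κ, Real.sqrt (Torus.freqNormSq κ) * ‖mFourierCoeff (EuclideanSpace.complexify ∘ W) κ‖ ≤ M) →
      |∫ x, ⟪Torus.convect (Torus.realTrigPoly S C) (Torus.realTrigPoly S C) x, W x⟫_ℝ| ≤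
        2 * Real.pi * M * (∑ κ ∈ S, ‖C κ‖) ^ 2) :=
  ⟨Dictionary.shearField_facts, Dictionary.fc_linearisedTransport, Dictionary.abs_integral_inner_le_slope_sum,
    Dictionary.abs_integral_inner_convect_realTrigPoly_le⟩

end Summit.AnomalousDissipation.AnomalousDissipation.Theorems.KolmogorovFloor.Response
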